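import Summits.CriticalPhenomena.PercolationContinuityZ3.Theorems.Transplant.FKDoubleFanD3RoofRoof111R1R1rx10_1o2
import Summits.CriticalPhenomena.PercolationContinuityZ3.Theorems.Transplant.FKDoubleFanD3RoofRoof111R1R1rx11o2_3o4
import Summits.CriticalPhenomena.PercolationContinuityZ3.Theorems.Transplant.FKDoubleFanD3RoofRoof111R1R1rx13o4_1
import HarnessLib

/-!
# Double fans `K₂ ∨ P_{m+1}`, family `(1,1,1)`: the roof–roof pair `(R₁,R₁)` — CLOSED (three parameter regions glued)

Helper file (`--supports stmt-CriticalPhenomena-4575`), FK sub-lane `prim-bschramm-fk-3` (gen 51); builds on p205010 (kernel theorem, internal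
audit signed; external expert review pending).  No named facts, no sorries, default heartbeats; standard axioms.  Memo
`bschramm/prim-bschramm-fk-3/FAR-CROSS-XXVI.md` §9.

For the pair `(R₁(w),R₁(v))` of the word `(1,1,1)` no CONSTANT outer multiplier works on the whole parameter box: the endpoint leaf `I.p2`
forces `t ≳ 7.5` near `x1 → 1` (`q = 1/2`, `y1 = y2 = 0`), while the inner certificate of `II.p1` needs `t ≲ 6.5` for small `x1`.  The
multiplier may depend on the parameters (only not on the quadratic's own variable), so the box is cut along `x1`:
`x1 ∈ [0,1/2]` with `t = 5` («…rx10_1o2»), `x1 ∈ [1/2,3/4]` with `t = 6` («…rx11o2_3o4»), `x1 ∈ [3/4,1]` with `t = 8` («…rx13o4_1»),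
each certified exactly (rows orientation).  This file glues the three regional theorems (**`parts111_R1_R1`**).
[folklore]
-/

noncomputable section

namespace Summit.CriticalPhenomena.PercolationContinuityZ3.Theorems

namespace FK

namespace ThreeApex

/-- **Pair `(R₁(w), R₁(v))` of `(1,1,1)` is non-negative** (`q ∈ [1/2,1]`, spokes and probes in `[0,1]`), from the three `x1`-regions. [folklore] -/
theorem parts111_R1_R1 {q x1 y1 x2 y2 : ℝ} (hq0 : 1 / 2 ≤ q) (hq1 : q ≤ 1) (hx10 : 0 ≤ x1) (hx11 : x1 ≤ 1) (hy10 : 0 ≤ y1) (hy11 : y1 ≤ 1)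
    (hx20 : 0 ≤ x2) (hx21 : x2 ≤ 1) (hy20 : 0 ≤ y2) (hy21 : y2 ≤ 1) {w v : ℝ} (hw0 : 0 ≤ w) (hw1 : w ≤ 1) (hv0 : 0 ≤ v) (hv1 : v ≤ 1) :
    0 ≤ pcell2 q 1 1 1 x1 y1 x2 y2 (roofR1 q w) (roofR1 q v) := by
  rcases le_total x1 (1 / 2) with h | h
  · exact parts111_R1_R1_rx10_1o2 hq0 hq1 hx10 hx11 hy10 hy11 hx20 hx21 hy20 hy21 hx10 h hw0 hw1 hv0 hv1
  · rcases le_total x1 (3 / 4) with h' | h'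
    · exact parts111_R1_R1_rx11o2_3o4 hq0 hq1 hx10 hx11 hy10 hy11 hx20 hx21 hy20 hy21 h h' hw0 hw1 hv0 hv1
    · exact parts111_R1_R1_rx13o4_1 hq0 hq1 hx10 hx11 hy10 hy11 hx20 hx21 hy20 hy21 h' hx11 hw0 hw1 hv0 hv1

end ThreeApex

end FK

end Summit.CriticalPhenomena.PercolationContinuityZ3.Theorems
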